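import Literature.Geometry.Lorentzian.CoordCurvatureNormEvolution
import Literature.Geometry.Lorentzian.CoordEntropyEvolution
import Literature.Geometry.Lorentzian.CoordSigma2Linearization
import Mathlib.Algebra.Order.Chebyshev
import HarnessLib

/-!
# Cauchy–Schwarz inequalities for the metric pairing of bilinear forms, and the frame bound
# for the curvature pairing `Rm ∗ β ∗ β`, in coordinates

Pointwise linear algebra at ONE point `x` of an open set `V` carrying metric components
`G : E → (E →L E →L ℝ)` (`IsMetricOn G V`, `CoordCurvature.lean` ff.) at which `G x` is
**positive definite**, read in a `G x`-orthonormal basis `e` (`exists_orthonormal_basis`):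
`♯ = sharpAt`, `g^{ij} = ginv`, metric pairing `⟨α, β⟩_G = pairAt`, square norm
`|β|²_G = normSqAt`, covariant derivative `∇β = cov₂At`, curvature endomorphism `R = riemAt`,
`|Rm|² = rmNormSqAt`.

Support file for Hamilton 1982, §11 (the gradient estimate for the scalar curvature,
Thm. 11.1 / Lemmas 11.2–11.6, with §§7, 10) as used by the crux `ChangGurskyYang` of the route
SmoothPoincare4/EntropyRung (item stmt-SmoothPoincare4-10834, line margerin-cone-hamilton-rails,
stub `stub_gradientEstimates`): the elementary estimates with which the reaction terms of the
evolution equations of `|Ric|²` and `|∇S|²` are absorbed.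

* `sum_coord_apply_eq_of_isLinear`, `sum_ginv_bilin_eq_sum_frame` — basis independence of the
  traces `Σ_k bᵏ(A b_k)` and `Σ g^{ij} F(b_i, b_j)`; `bilin_apply_eq_sum_frame`
  (`β(v,w) = Σ_p G(v,e_p) β(e_p,w)`), `sq_sum_sum_abs_le` (`(Σ_{ij}|a_{ij}|)² ≤ n² Σ_{ij} a_{ij}²`);
* `IsMetricOn.curvPair_eq_sum_frame` — the curvature pairing
  `B(β, γ) = Σ g^{ij} Σ_k bᵏ(♯((β.flip b_j) ∘ R(b_i, ♯(γ b_k))))` in an orthonormal frame: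
  `B(β, γ) = Σ_{ckmp} γ(e_k,e_m) R_{cmkp} β(e_p,e_c)`, `R_{cmkp} = G(R(e_c,e_m)e_k, e_p)`;
* `IsMetricOn.abs_curvPair_le` — **`|B(β,β)| ≤ n² √|Rm|² |β|²`** (`n = dim E`);
* `IsMetricOn.pairAt_sq_le` — **Cauchy–Schwarz `⟨α,β⟩² ≤ |α|²|β|²`** for symmetric forms;
  `IsMetricOn.normSqAt_nonneg_of_symm` — `0 ≤ |β|²`;
* `IsMetricOn.sum_ginv_pairAt_cov₂At_eq_sum_frame` — `|∇β|² := Σ g^{kl}⟨∇_{b_k}β, ∇_{b_l}β⟩ =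
  Σ_c ⟨∇_{e_c}β, ∇_{e_c}β⟩`; `IsMetricOn.cov₂At_symm_of_symmOn` (`∇_Wβ` is symmetric for a field of
  symmetric forms); `IsMetricOn.covNormSq_nonneg` — **`0 ≤ |∇β|²`**;
  `IsMetricOn.normSqAt_cov₂At_sharpAt_le` — **`|∇_{♯φ}β|² ≤ |∇β|² φ(♯φ)`** for a smooth field
  of symmetric forms.

Everything is proved; no definition and no statement of `Prop` type is introduced.

## References

* R. S. Hamilton, *Three-manifolds with positive Ricci curvature*, J. Differential Geom. 17
  (1982) 255–306, §7 (evolution of curvature), §10, §11 (Thm. 11.1, Lemmas 11.2–11.6).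
  [Hamilton1982]
* G. Huisken, *Ricci deformation of the metric on a Riemannian manifold*, J. Differential
  Geom. 21 (1985) 47–62, §4. [Huisken1985]
* B. O'Neill, *Semi-Riemannian geometry with applications to relativity*, Academic Press 1983,
  Ch. 2, Lemma 2.25 (orthonormal expansion); Ch. 3, pp. 60–61 (metric contraction). [ONeill1983]
* P. Topping, *Lectures on the Ricci flow*, LMS Lecture Note Series 325, CUP 2006, §2
  (norms of tensors), §3.2, p. 37. [Topping2006]
-/

noncomputable section

set_option maxSynthPendingDepth 3

open Set Filter ContinuousLinearMap Module
open scoped Topology ContDiff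

namespace Literature.Geometry.Lorentzian

namespace MetricCoord

variable {E : Type*} [NormedAddCommGroup E] [NormedSpace ℝ E] [FiniteDimensional ℝ E]

/-! ### Basis independence of traces, and the curvature pairing in an orthonormal frame -/

section Frame

variable {ι : Type*} [Fintype ι] [DecidableEq ι] {G : E → E →L[ℝ] E →L[ℝ] ℝ} {V : Set E} {x : E}

omit [DecidableEq ι] [FiniteDimensional ℝ E] in
/-- **The basis trace formula is basis independent**: for an additive homogeneous map `A`,
`Σ_k bᵏ(A b_k) = Σ_i eⁱ(A e_i)` (both are `tr A`). [folklore] -/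
theorem sum_coord_apply_eq_of_isLinear {κ : Type*} [Fintype κ] (b : Basis κ ℝ E)
    (e : Basis ι ℝ E) (A : E → E) (h₁ : ∀ u v, A (u + v) = A u + A v)
    (h₂ : ∀ (c : ℝ) u, A (c • u) = c • A u) :
    ∑ k, b.coord k (A (b k)) = ∑ i, e.coord i (A (e i)) := by
  have hb := trace_eq_sum_coord b (IsLinearMap.mk' A ⟨h₁, h₂⟩)
  have he := trace_eq_sum_coord e (IsLinearMap.mk' A ⟨h₁, h₂⟩)
  simp only [IsLinearMap.mk'_apply] at hb he
  rw [← hb, ← he]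

/-- `(Σ_{ij} |β(e_i,e_j)|)² ≤ n² Σ_{ij} β(e_i,e_j)²` (Cauchy–Schwarz with the all-ones vector,
twice). [folklore] -/
theorem sq_sum_sum_abs_le {κ : Type*} [Fintype κ] (a : κ → κ → ℝ) :
    (∑ i, ∑ j, |a i j|) ^ 2 ≤ (Fintype.card κ : ℝ) ^ 2 * ∑ i, ∑ j, a i j ^ 2 := by
  have h1 : (∑ i, ∑ j, |a i j|) ^ 2 ≤ Fintype.card κ * ∑ i, (∑ j, |a i j|) ^ 2 := by
    have h := sq_sum_le_card_mul_sum_sq (s := Finset.univ) (f := fun i ↦ ∑ j, |a i j|)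
    rwa [Finset.card_univ] at h
  have h2 : ∀ i, (∑ j, |a i j|) ^ 2 ≤ Fintype.card κ * ∑ j, a i j ^ 2 := by
    intro i
    have h := sq_sum_le_card_mul_sum_sq (s := Finset.univ) (f := fun j ↦ |a i j|)
    simp only [Finset.card_univ, sq_abs] at h
    exact h
  have hn : (0 : ℝ) ≤ Fintype.card κ := Nat.cast_nonneg _
  calc (∑ i, ∑ j, |a i j|) ^ 2 ≤ Fintype.card κ * ∑ i, (∑ j, |a i j|) ^ 2 := h1
    _ ≤ Fintype.card κ * ∑ i, (Fintype.card κ * ∑ j, a i j ^ 2) :=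
        mul_le_mul_of_nonneg_left (Finset.sum_le_sum fun i _ ↦ h2 i) hn
    _ = (Fintype.card κ : ℝ) ^ 2 * ∑ i, ∑ j, a i j ^ 2 := by
        rw [← Finset.mul_sum]; ring

variable (e : Basis ι ℝ E) (he : ∀ i j, G x (e i) (e j) = if i = j then 1 else 0)
include he

/-- **`Σ_{ij} g^{ij} F(b_i, b_j) = Σ_c F(e_c, e_c)`** for a bilinear real function `F`, any basis
`b` and a `G x`-orthonormal basis `e` (both are the metric trace of `F`).
[cite: ONeill1983, Ch. 3, p. 60] -/
theorem sum_ginv_bilin_eq_sum_frame (hi : (G x).IsInvertible) {κ : Type*} [Fintype κ]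
    (b : Basis κ ℝ E) (F : E → E → ℝ) (h₁ : ∀ u₁ u₂ w, F (u₁ + u₂) w = F u₁ w + F u₂ w)
    (h₂ : ∀ (c : ℝ) u w, F (c • u) w = c * F u w)
    (h₃ : ∀ u w₁ w₂, F u (w₁ + w₂) = F u w₁ + F u w₂)
    (h₄ : ∀ (c : ℝ) u w, F u (c • w) = c * F u w) :
    ∑ i, ∑ j, ginv G b x i j * F (b i) (b j) = ∑ c, F (e c) (e c) := by
  have h := sum_ginv_mul_eq_sum_frame e he hi b (mkCLM₂ F h₁ h₂ h₃ h₄)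
  simpa only [mkCLM₂_apply] using h

omit [FiniteDimensional ℝ E] in
/-- Expansion of the first slot of a bilinear form in an orthonormal frame:
`β(v, w) = Σ_p G(v, e_p) β(e_p, w)`. [cite: ONeill1983, Ch. 2, Lemma 2.25] -/
theorem bilin_apply_eq_sum_frame (β : E →L[ℝ] E →L[ℝ] ℝ) (v w : E) :
    β v w = ∑ p, G x v (e p) * β (e p) w := by
  conv_lhs => rw [← sum_apply_smul_of_orthonormal e he v]
  simp only [map_sum, map_smul, _root_.sum_apply, _root_.smul_apply, smul_eq_mul]

/-- **The curvature pairing in an orthonormal frame**: for any basis `b` and a `G x`-orthonormal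
basis `e`, `Σ_{ij} g^{ij} Σ_k bᵏ(♯((β.flip b_j) ∘ R(b_i, ♯(γ b_k))))
= Σ_{c k m p} γ(e_k, e_m) G(R(e_c, e_m)e_k, e_p) β(e_p, e_c)` (the `Rm ∗ γ` term of Hamilton
1982, Cor. 7.3, paired with `β`). [cite: Hamilton1982, §7, Cor. 7.3] -/
theorem IsMetricOn.curvPair_eq_sum_frame (hG : IsMetricOn G V) (hx : x ∈ V) {κ : Type*}
    [Fintype κ] (b : Basis κ ℝ E) (β γ : E →L[ℝ] E →L[ℝ] ℝ) :
    ∑ i, ∑ j, ginv G b x i j * ∑ k, b.coord k (sharpAt G x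
        ((β.flip (b j)).comp (riemAt G x (b i) (sharpAt G x (γ (b k))))))
      = ∑ c, ∑ k, ∑ m, ∑ p,
          γ (e k) (e m) * G x (riemAt G x (e c) (e m) (e k)) (e p) * β (e p) (e c) := by
  have hi := hG.isInvertible x hx
  have hs := hG.symm x hx
  -- (1) the outer contraction in the frame
  have h1 : ∑ i, ∑ j, ginv G b x i j * ∑ k, b.coord k (sharpAt G x
        ((β.flip (b j)).comp (riemAt G x (b i) (sharpAt G x (γ (b k)))))) =
      ∑ c, ∑ k, b.coord k (sharpAt G x
        ((β.flip (e c)).comp (riemAt G x (e c) (sharpAt G x (γ (b k)))))) :=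
    sum_ginv_bilin_eq_sum_frame e he hi b (fun u w ↦ ∑ k, b.coord k (sharpAt G x
        ((β.flip w).comp (riemAt G x u (sharpAt G x (γ (b k)))))))
      (fun u₁ u₂ w ↦ by
        simp only [riemAt_add_left, ContinuousLinearMap.comp_add, map_add, Finset.sum_add_distrib])
      (fun c u w ↦ by
        simp only [riemAt_smul_left, ContinuousLinearMap.comp_smul, map_smul, smul_eq_mul,
          Finset.mul_sum])
      (fun u w₁ w₂ ↦ by
        simp only [map_add, ContinuousLinearMap.add_comp, Finset.sum_add_distrib])
      (fun c u w ↦ by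
        simp only [map_smul, ContinuousLinearMap.smul_comp, smul_eq_mul, Finset.mul_sum])
  -- (2) the inner trace in the frame
  have h2 : ∀ c, ∑ k, b.coord k (sharpAt G x
        ((β.flip (e c)).comp (riemAt G x (e c) (sharpAt G x (γ (b k)))))) =
      ∑ k, e.coord k (sharpAt G x
        ((β.flip (e c)).comp (riemAt G x (e c) (sharpAt G x (γ (e k)))))) :=
    fun c ↦ sum_coord_apply_eq_of_isLinear b e
      (fun v ↦ sharpAt G x ((β.flip (e c)).comp (riemAt G x (e c) (sharpAt G x (γ v)))))
      (fun u v ↦ by simp only [map_add, riemAt_add_right, ContinuousLinearMap.comp_add])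
      (fun a v ↦ by simp only [map_smul, riemAt_smul_right, ContinuousLinearMap.comp_smul])
  -- (3) evaluation of a summand
  have h3 : ∀ c k, e.coord k (sharpAt G x
        ((β.flip (e c)).comp (riemAt G x (e c) (sharpAt G x (γ (e k)))))) =
      ∑ m, ∑ p, γ (e k) (e m) * G x (riemAt G x (e c) (e m) (e k)) (e p) * β (e p) (e c) := by
    intro c k
    rw [coord_eq_apply_of_orthonormal e he, apply_sharpAt_apply hi,
      ContinuousLinearMap.comp_apply, flip_apply, sharpAt_eq_sum_frame e he hi hs (γ (e k)),
      ← riemCLM_apply, map_sum, _root_.sum_apply, map_sum, _root_.sum_apply]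
    refine Finset.sum_congr rfl fun m _ ↦ ?_
    rw [map_smul, _root_.smul_apply, map_smul, _root_.smul_apply, smul_eq_mul, riemCLM_apply,
      bilin_apply_eq_sum_frame e he β, Finset.mul_sum]
    exact Finset.sum_congr rfl fun p _ ↦ by ring
  rw [h1]
  exact Finset.sum_congr rfl fun c _ ↦ by
    rw [h2 c]
    exact Finset.sum_congr rfl fun k _ ↦ h3 c k

end Frame

namespace IsMetricOn

variable {G : E → E →L[ℝ] E →L[ℝ] ℝ} {V : Set E} {x : E} {ι : Type*} [Fintype ι] (b : Basis ι ℝ E)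

/-! ### Cauchy–Schwarz for the pairing of symmetric forms -/

/-- (C5a') `0 ≤ |β|²` for symmetric `β` at a positive definite point. [folklore] -/
theorem normSqAt_nonneg_of_symm (hG : IsMetricOn G V) (hx : x ∈ V) (hpos : ∀ v : E, v ≠ 0 → 0 < G x v v)
    {β : E →L[ℝ] E →L[ℝ] ℝ} (hβ : ∀ v w, β v w = β w v) : 0 ≤ normSqAt G x β := by
  have hi := hG.isInvertible x hx
  have hs := hG.symm x hx
  obtain ⟨e, he⟩ := exists_orthonormal_basis hs hpos
  rw [← pairAt_self_of_symm G x hβ, pairAt_eq_sum_frame e he hi hs]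
  exact Finset.sum_nonneg fun i _ ↦ Finset.sum_nonneg fun j _ ↦ by
    rw [hβ (e j) (e i)]
    exact mul_self_nonneg _

/-- (C5a) Cauchy–Schwarz for the pairing of symmetric forms at a positive definite point. [folklore] -/
theorem pairAt_sq_le (hG : IsMetricOn G V) (hx : x ∈ V) (hpos : ∀ v : E, v ≠ 0 → 0 < G x v v)
    {α β : E →L[ℝ] E →L[ℝ] ℝ} (hα : ∀ v w, α v w = α w v) (hβ : ∀ v w, β v w = β w v) :
    pairAt G x α β ^ 2 ≤ normSqAt G x α * normSqAt G x β := by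
  have hi := hG.isInvertible x hx
  have hs := hG.symm x hx
  obtain ⟨e, he⟩ := exists_orthonormal_basis hs hpos
  have hflat : ∀ f : Fin (finrank ℝ E) → Fin (finrank ℝ E) → ℝ,
      ∑ i, ∑ j, f i j = ∑ p : Fin (finrank ℝ E) × Fin (finrank ℝ E), f p.1 p.2 :=
    fun f ↦ (Fintype.sum_prod_type' f).symm
  rw [← pairAt_self_of_symm G x hα, ← pairAt_self_of_symm G x hβ,
    pairAt_eq_sum_frame e he hi hs, pairAt_eq_sum_frame e he hi hs,
    pairAt_eq_sum_frame e he hi hs, hflat, hflat, hflat]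
  calc (∑ p : Fin (finrank ℝ E) × Fin (finrank ℝ E), α (e p.2) (e p.1) * β (e p.1) (e p.2)) ^ 2
      = (∑ p : Fin (finrank ℝ E) × Fin (finrank ℝ E), α (e p.1) (e p.2) * β (e p.1) (e p.2)) ^ 2 := by
        congr 1
        exact Finset.sum_congr rfl fun p _ ↦ by rw [hα]
    _ ≤ (∑ p : Fin (finrank ℝ E) × Fin (finrank ℝ E), α (e p.1) (e p.2) ^ 2)
          * ∑ p : Fin (finrank ℝ E) × Fin (finrank ℝ E), β (e p.1) (e p.2) ^ 2 :=
        Finset.sum_mul_sq_le_sq_mul_sq _ _ _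
    _ = _ := by
        congr 1
        · exact Finset.sum_congr rfl fun p _ ↦ by rw [sq, hα]
        · exact Finset.sum_congr rfl fun p _ ↦ by rw [sq, hβ]

/-! ### The frame bound for the curvature pairing -/

/-- (C3) `|B(β,β)| ≤ n² √|Rm|² |β|²` for symmetric `β`, at a positive definite point
(`|Rm|² = rmNormSqAt`). [cite: Hamilton1982, §13] -/
theorem abs_curvPair_le (hG : IsMetricOn G V) (hx : x ∈ V) (hpos : ∀ v : E, v ≠ 0 → 0 < G x v v)
    {β : E →L[ℝ] E →L[ℝ] ℝ} (hβ : ∀ v w, β v w = β w v) :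
    |∑ i, ∑ j, ginv G b x i j * ∑ k, b.coord k (sharpAt G x
        ((β.flip (b j)).comp (riemAt G x (b i) (sharpAt G x (β (b k))))))|
      ≤ (finrank ℝ E : ℝ) ^ 2 * Real.sqrt (rmNormSqAt G x) * normSqAt G x β := by
  have hi := hG.isInvertible x hx
  have hs := hG.symm x hx
  obtain ⟨e, he⟩ := exists_orthonormal_basis hs hpos
  -- notation
  set K := Real.sqrt (rmNormSqAt G x) with hK
  set a : Fin (finrank ℝ E) → Fin (finrank ℝ E) → ℝ := fun i j ↦ |β (e i) (e j)|
  set s := ∑ i, ∑ j, a i j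
  have hK0 : 0 ≤ K := Real.sqrt_nonneg _
  have hRK : ∀ c m k p, |G x (riemAt G x (e c) (e m) (e k)) (e p)| ≤ K :=
    fun c m k p ↦ hG.abs_rm_le_sqrt e he hx c m k p
  -- the pairing in the frame, with `β(e_p, e_c) = β(e_c, e_p)`
  have hB : ∑ i, ∑ j, ginv G b x i j * ∑ k, b.coord k (sharpAt G x
        ((β.flip (b j)).comp (riemAt G x (b i) (sharpAt G x (β (b k)))))) =
      ∑ c, ∑ k, ∑ m, ∑ p, β (e k) (e m) * G x (riemAt G x (e c) (e m) (e k)) (e p) * β (e c) (e p) := by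
    rw [hG.curvPair_eq_sum_frame e he hx b β β]
    exact Finset.sum_congr rfl fun c _ ↦ Finset.sum_congr rfl fun k _ ↦
      Finset.sum_congr rfl fun m _ ↦ Finset.sum_congr rfl fun p _ ↦ by rw [hβ (e p) (e c)]
  -- termwise bound
  have hterm : ∀ c k m p, |β (e k) (e m) * G x (riemAt G x (e c) (e m) (e k)) (e p) * β (e c) (e p)|
      ≤ a k m * K * a c p := by
    intro c k m p
    rw [abs_mul, abs_mul]
    exact mul_le_mul_of_nonneg_right (mul_le_mul_of_nonneg_left (hRK c m k p) (abs_nonneg _))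
      (abs_nonneg _)
  -- rearrangement of the majorant
  have hre : ∑ c, ∑ k, ∑ m, ∑ p, a k m * K * a c p = K * s * s := by
    calc ∑ c, ∑ k, ∑ m, ∑ p, a k m * K * a c p
        = ∑ c, (∑ k, ∑ m, a k m * K) * ∑ p, a c p := by
          refine Finset.sum_congr rfl fun c _ ↦ ?_
          rw [Finset.sum_mul]
          refine Finset.sum_congr rfl fun k _ ↦ ?_
          rw [Finset.sum_mul]
          exact Finset.sum_congr rfl fun m _ ↦ by rw [Finset.mul_sum]
      _ = (∑ k, ∑ m, a k m * K) * ∑ c, ∑ p, a c p := by rw [← Finset.mul_sum]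
      _ = K * s * s := by
          simp only [← Finset.sum_mul]
          ring
  -- Cauchy–Schwarz with the all-ones vector
  have hCS : s ^ 2 ≤ (finrank ℝ E : ℝ) ^ 2 * normSqAt G x β := by
    have h := sq_sum_sum_abs_le fun i j ↦ β (e i) (e j)
    rwa [Fintype.card_fin, ← normSqAt_eq_sum_frame e he hi hs β] at h
  calc |∑ i, ∑ j, ginv G b x i j * ∑ k, b.coord k (sharpAt G x
          ((β.flip (b j)).comp (riemAt G x (b i) (sharpAt G x (β (b k))))))|
      = |∑ c, ∑ k, ∑ m, ∑ p,
          β (e k) (e m) * G x (riemAt G x (e c) (e m) (e k)) (e p) * β (e c) (e p)| := by rw [hB]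
    _ ≤ ∑ c, ∑ k, ∑ m, ∑ p, a k m * K * a c p :=
        (Finset.abs_sum_le_sum_abs _ _).trans (Finset.sum_le_sum fun c _ ↦
          (Finset.abs_sum_le_sum_abs _ _).trans (Finset.sum_le_sum fun k _ ↦
            (Finset.abs_sum_le_sum_abs _ _).trans (Finset.sum_le_sum fun m _ ↦
              (Finset.abs_sum_le_sum_abs _ _).trans (Finset.sum_le_sum fun p _ ↦ hterm c k m p))))
    _ = K * s ^ 2 := by rw [hre]; ring
    _ ≤ K * ((finrank ℝ E : ℝ) ^ 2 * normSqAt G x β) := mul_le_mul_of_nonneg_left hCS hK0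
    _ = (finrank ℝ E : ℝ) ^ 2 * Real.sqrt (rmNormSqAt G x) * normSqAt G x β := by rw [hK]; ring

/-! ### The square norm of the covariant derivative of a field of symmetric forms -/

/-- **`|∇β|²` in an orthonormal frame**: for any basis `b` and a `G x`-orthonormal basis `e`,
`Σ_{kl} g^{kl} ⟨∇_{b_k}β, ∇_{b_l}β⟩ = Σ_c ⟨∇_{e_c}β, ∇_{e_c}β⟩`. [cite: Hamilton1982, §7] -/
theorem sum_ginv_pairAt_cov₂At_eq_sum_frame (hG : IsMetricOn G V) (hx : x ∈ V)
    {κ : Type*} [Fintype κ] [DecidableEq κ] (e : Basis κ ℝ E)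
    (he : ∀ i j, G x (e i) (e j) = if i = j then 1 else 0) (β : E → E →L[ℝ] E →L[ℝ] ℝ) :
    ∑ k, ∑ l, ginv G b x k l * pairAt G x (cov₂At G β x (b k)) (cov₂At G β x (b l))
      = ∑ c, pairAt G x (cov₂At G β x (e c)) (cov₂At G β x (e c)) :=
  sum_ginv_bilin_eq_sum_frame e he (hG.isInvertible x hx) b
    (fun v w ↦ pairAt G x (cov₂At G β x v) (cov₂At G β x w))
    (fun u₁ u₂ w ↦ by simp only [map_add, pairAt_add_left])
    (fun c u w ↦ by simp only [map_smul, pairAt_smul_left])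
    (fun u w₁ w₂ ↦ by simp only [map_add, pairAt_add_right])
    (fun c u w ↦ by simp only [map_smul, pairAt_smul_right])

omit [FiniteDimensional ℝ E] in
/-- The covariant derivative of a smooth field of symmetric forms is symmetric in its form slots.
[folklore] -/
theorem cov₂At_symm_of_symmOn (hG : IsMetricOn G V) (hx : x ∈ V) {β : E → E →L[ℝ] E →L[ℝ] ℝ}
    (hβ : ContDiffOn ℝ ∞ β V) (hs : ∀ y ∈ V, ∀ v w, β y v w = β y w v) (W Y Z : E) :
    cov₂At G β x W Y Z = cov₂At G β x W Z Y := by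
  refine cov₂At_symm (((hβ x hx).contDiffAt (hG.mem_nhds hx)).differentiableAt (by simp)) ?_ W Y Z
  filter_upwards [hG.mem_nhds hx] with y hy using hs y hy

/-- (C5c) `0 ≤ |∇β|²` at a positive definite point. [folklore] -/
theorem covNormSq_nonneg (hG : IsMetricOn G V) (hx : x ∈ V)
    (hpos : ∀ v : E, v ≠ 0 → 0 < G x v v) {β : E → E →L[ℝ] E →L[ℝ] ℝ} (hβ : ContDiffOn ℝ ∞ β V)
    (hs : ∀ y ∈ V, ∀ v w, β y v w = β y w v) :
    0 ≤ ∑ k, ∑ l, ginv G b x k l * pairAt G x (cov₂At G β x (b k)) (cov₂At G β x (b l)) := by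
  obtain ⟨e, he⟩ := exists_orthonormal_basis (hG.symm x hx) hpos
  rw [hG.sum_ginv_pairAt_cov₂At_eq_sum_frame b hx e he β]
  refine Finset.sum_nonneg fun c _ ↦ ?_
  have hsym : ∀ v w, cov₂At G β x (e c) v w = cov₂At G β x (e c) w v :=
    hG.cov₂At_symm_of_symmOn hx hβ hs (e c)
  rw [pairAt_self_of_symm G x hsym]
  exact hG.normSqAt_nonneg_of_symm hx hpos hsym

/-- (C5b) `|∇_{♯φ} β|² ≤ |∇β|² · φ(♯φ)` for a field of symmetric forms, at a positive definite point.
[folklore] -/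
theorem normSqAt_cov₂At_sharpAt_le (hG : IsMetricOn G V) (hx : x ∈ V)
    (hpos : ∀ v : E, v ≠ 0 → 0 < G x v v) {β : E → E →L[ℝ] E →L[ℝ] ℝ} (hβ : ContDiffOn ℝ ∞ β V)
    (hs : ∀ y ∈ V, ∀ v w, β y v w = β y w v) (φ : E →L[ℝ] ℝ) :
    normSqAt G x (cov₂At G β x (sharpAt G x φ))
      ≤ (∑ k, ∑ l, ginv G b x k l * pairAt G x (cov₂At G β x (b k)) (cov₂At G β x (b l)))
        * φ (sharpAt G x φ) := by
  have hi := hG.isInvertible x hx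
  have hsy := hG.symm x hx
  obtain ⟨e, he⟩ := exists_orthonormal_basis hsy hpos
  have hsym : ∀ c (v w : E), cov₂At G β x (e c) v w = cov₂At G β x (e c) w v :=
    fun c ↦ hG.cov₂At_symm_of_symmOn hx hβ hs (e c)
  -- the three quantities in the frame
  have hL : normSqAt G x (cov₂At G β x (sharpAt G x φ)) =
      ∑ i, ∑ j, (∑ k, φ (e k) * cov₂At G β x (e k) (e i) (e j)) ^ 2 := by
    rw [normSqAt_eq_sum_frame e he hi hsy, sharpAt_eq_sum_frame e he hi hsy φ, map_sum]
    refine Finset.sum_congr rfl fun i _ ↦ Finset.sum_congr rfl fun j _ ↦ ?_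
    simp only [map_smul, _root_.sum_apply, _root_.smul_apply, smul_eq_mul]
  have hR : ∑ k, ∑ l, ginv G b x k l * pairAt G x (cov₂At G β x (b k)) (cov₂At G β x (b l)) =
      ∑ k, ∑ i, ∑ j, cov₂At G β x (e k) (e i) (e j) ^ 2 := by
    rw [hG.sum_ginv_pairAt_cov₂At_eq_sum_frame b hx e he β]
    refine Finset.sum_congr rfl fun k _ ↦ ?_
    rw [pairAt_self_of_symm G x (hsym k), normSqAt_eq_sum_frame e he hi hsy]
  have hφ : φ (sharpAt G x φ) = ∑ k, φ (e k) ^ 2 := by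
    rw [apply_sharpAt_eq_sum_frame e he hi hsy]
    exact Finset.sum_congr rfl fun k _ ↦ by rw [sq]
  rw [hL, hR, hφ]
  calc ∑ i, ∑ j, (∑ k, φ (e k) * cov₂At G β x (e k) (e i) (e j)) ^ 2
      ≤ ∑ i, ∑ j, (∑ k, φ (e k) ^ 2) * ∑ k, cov₂At G β x (e k) (e i) (e j) ^ 2 :=
        Finset.sum_le_sum fun i _ ↦ Finset.sum_le_sum fun j _ ↦ Finset.sum_mul_sq_le_sq_mul_sq _ _ _
    _ = (∑ k, φ (e k) ^ 2) * ∑ i, ∑ j, ∑ k, cov₂At G β x (e k) (e i) (e j) ^ 2 := by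
        simp only [Finset.mul_sum]
    _ = (∑ k, ∑ i, ∑ j, cov₂At G β x (e k) (e i) (e j) ^ 2) * ∑ k, φ (e k) ^ 2 := by
        rw [mul_comm]
        congr 1
        calc ∑ i, ∑ j, ∑ k, cov₂At G β x (e k) (e i) (e j) ^ 2
            = ∑ i, ∑ k, ∑ j, cov₂At G β x (e k) (e i) (e j) ^ 2 :=
              Finset.sum_congr rfl fun i _ ↦ Finset.sum_comm
          _ = ∑ k, ∑ i, ∑ j, cov₂At G β x (e k) (e i) (e j) ^ 2 := Finset.sum_comm

end IsMetricOn

end MetricCoord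

end Literature.Geometry.Lorentzian

end
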